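import Summits.NavierStokesRegularity.FluidComputer.BlockEnergyTransport
import HarnessLib

/-!
# Fluid computer — the block energy balance WITH DISSIPATION along a maximal smooth solution (local step)

HONEST FRAMING (cell `pub-fluidc`, verbatim): *low prior, high value-of-information experiment on Tao's
machine paradigm; NOT a claim that NS blows up.* Theorem side of the cell (support file of the viscous rent L12⁗,
`BlockViscousRent`); nothing here is evidence of blow-up.

`BlockEnergyTransport.piece_blockEnergy` carried Cheskidov–Shvydkoy's block balance (8)
(`IsSmoothSlabSolution.blockEnergy_eq`) to the pieces of a maximal smooth finite-energy solution with the viscous term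
DROPPED. Keeping it requires splitting the exact balance `a_j(t)² − a_j(s)² = 2∫(−ν S_j − N_j)` into its viscous part
`S_j(τ) = ∑_i ‖∂_i Δ̇_j v(τ)‖₂²` and its transfer part `N_j(τ) = ∫ ⟪Δ̇_j v(τ), Δ̇_j((v·∇)v)(τ)⟫`, i.e. the
TIME-INTEGRABILITY OF THE TRANSFER TERM along Leray's regular local solutions — the one new analytic input of this file:

* `integrableOn_transfer` — on a compact sub-slab `[a, b] ⊂ (0, d]` of a classical solution whose velocity and
  velocity gradient are uniformly bounded and whose slices have uniformly bounded energy, `τ ↦ N_j(v(τ))` is integrable: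
  the two blocks are jointly continuous in `(τ, x)` (`continuousOn_blockFn_uncurry`, blocks of jointly continuous
  bounded fields), hence `N_j` is measurable in `τ` (Fubini), and Cauchy–Schwarz with `‖Δ̇_j f‖₂ ≤ C₂‖f‖₂`,
  `‖(v·∇)v‖₂ ≤ ‖∇v‖_∞ ‖v‖₂` bounds it uniformly;
* `piece_blockEnergy_visc` — the LOCAL STEP with dissipation: in the setting of `BlockEnergyTransport.piece_blockEnergy`
  (good restarting time `σ`, Leray lifespan `d`), for `σ < s ≤ t ≤ σ + d`, `t < T`, every level `j`:
  `‖Δ̇_j u(t)‖₂² + 2ν ∫⁻_{(s,t]} ∑_i ‖∂_i Δ̇_j u(τ)‖₂² dτ ≤ ‖Δ̇_j u(s)‖₂² + 2 ∫⁻_{(s,t]} (−N_j(u(τ)))⁺ dτ`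
  (`gradSq (Δ̇_j u(τ)) = ∑_i ‖∂_i Δ̇_j u(τ)‖₂²`; lower integrals, no integrability exported).

0 sorry; no new definitions, no named facts (inputs: `leray_local_regular_H1_holds`,
`serrin_weak_strong_uniqueness_holds`, `isSmoothSlabSolution_of_regular`, `IsSmoothSlabSolution.blockEnergy_eq`,
`IsSmoothSlabSolution.intervalIntegrable_rhs`, `continuousOn_blockFn_uncurry`).

## References

* A. Cheskidov, R. Shvydkoy, Arch. Ration. Mech. Anal. 195 (2010) 159–169 = arXiv:0708.3067, Lemma 3.2 (proof, (8)):
  `(1/2) d/dt ‖u_q‖₂² + ν λ_q² ‖u_q‖₂² ≲ ∫ tr[(u⊗u)_q · ∇u_q]`. [CheskidovShvydkoy2010]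
* J. C. Robinson, J. L. Rodrigo, W. Sadowski, *The Three-Dimensional Navier–Stokes Equations*, CUP 2016, Thm. 6.10,
  Thm. 6.15. [RobinsonRodrigoSadowski2016]
-/

noncomputable section

open MeasureTheory Set Function Filter Topology
open scoped ENNReal NNReal RealInnerProductSpace
open Literature.Analysis.FluidPDE Literature.Analysis.FunctionSpaces
open Literature.Analysis.FluidPDE.LPBounds (gradSq)
open Summit.NavierStokesRegularity.FluidComputer.BlockEnergyTransport

namespace Summit.NavierStokesRegularity.FluidComputer.BlockEnergyDissipation

/-! ## Time-integrability of the transfer term along a regular slab -/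

/-- **The transfer term is integrable in time on a regular sub-slab.** Let `(v, q)` be a classical solution of the
unforced system on `ℝ³ × (0, d]` whose velocity and velocity gradient are uniformly bounded on `[a, d] × ℝ³`
(`0 < a`) and whose slices have uniformly bounded energy there. Then for `a ≤ b ≤ d` and every level `j` the transfer
term `τ ↦ N_j(v(τ)) = ∫ ⟪Δ̇_j v(τ), Δ̇_j((v·∇)v)(τ)⟫` is integrable on `[a, b]`: the two blocks are jointly continuous
in `(τ, x)` (`continuousOn_blockFn_uncurry`), so `N_j` is measurable in `τ` (Fubini), and Cauchy–Schwarz with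
`‖Δ̇_j f‖₂ ≤ C₂ ‖f‖₂`, `‖(v·∇)v‖₂ ≤ ‖∇v‖_∞ ‖v‖₂` bounds it uniformly. [folklore] -/
theorem integrableOn_transfer {ν d : ℝ}
    {v : ℝ → EuclideanSpace ℝ (Fin 3) → EuclideanSpace ℝ (Fin 3)} {q : ℝ → EuclideanSpace ℝ (Fin 3) → ℝ}
    (hns : IsClassicalNSSolutionOn (Ioc 0 d) ν 0 v q) {a b : ℝ} (ha : 0 < a) (hab : a ≤ b) (hbd : b ≤ d)
    {M₀ M₁ : ℝ} (hM₀ : ∀ t ∈ Icc a d, ∀ x, ‖v t x‖ ≤ M₀) (hM₁ : ∀ t ∈ Icc a d, ∀ x, ‖fderiv ℝ (v t) x‖ ≤ M₁)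
    {E₀ : ℝ≥0} (hE₀ : ∀ t ∈ Icc a d, eLpNorm (v t) 2 volume ≤ E₀) (j : ℤ) :
    IntegrableOn (fun τ => ∫ x, ⟪blockFn j (v τ) x, blockFn j (convect (v τ) (v τ)) x⟫) (Icc a b) volume := by
  set K := lpBounds (Fin 3) with hK
  have hsub : Icc a b ⊆ Ioc 0 d := fun t ht => ⟨ha.trans_le ht.1, ht.2.trans hbd⟩
  have hsub' : Icc a b ⊆ Icc a d := Icc_subset_Icc le_rfl hbd
  -- joint continuity of the two fields and their bounds
  have hcv : ContinuousOn (uncurry v) (Icc a b ×ˢ univ) :=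
    hns.smooth_velocity.continuousOn.mono (prod_mono hsub subset_rfl)
  have hcc : ContinuousOn (uncurry fun t x => convect (v t) (v t) x) (Icc a b ×ˢ univ) :=
    (hns.smooth_velocity.convect hns.smooth_velocity (uniqueDiffOn_Ioc 0 d)).continuousOn.mono
      (prod_mono hsub subset_rfl)
  have hM₁0 : 0 ≤ M₁ := (norm_nonneg (fderiv ℝ (v a) 0)).trans (hM₁ a ⟨le_rfl, hab.trans hbd⟩ 0)
  have hbv : ∀ t ∈ Icc a b, ∀ x, ‖v t x‖ ≤ M₀ := fun t ht x => hM₀ t (hsub' ht) x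
  have hbc : ∀ t ∈ Icc a b, ∀ x, ‖convect (v t) (v t) x‖ ≤ M₁ * M₀ := fun t ht x =>
    (ContinuousLinearMap.le_opNorm _ _).trans
      (mul_le_mul (hM₁ t (hsub' ht) x) (hM₀ t (hsub' ht) x) (norm_nonneg _) hM₁0)
  -- joint continuity of the integrand
  have hΦ : ContinuousOn (fun z : ℝ × EuclideanSpace ℝ (Fin 3) =>
      ⟪blockFn j (v z.1) z.2, blockFn j (convect (v z.1) (v z.1)) z.2⟫) (Icc a b ×ˢ univ) :=
    (continuousOn_blockFn_uncurry hcv hbv j).inner (continuousOn_blockFn_uncurry hcc hbc j)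
  -- measurability in `τ` (Fubini)
  have hΦm : AEStronglyMeasurable (fun z : ℝ × EuclideanSpace ℝ (Fin 3) =>
      ⟪blockFn j (v z.1) z.2, blockFn j (convect (v z.1) (v z.1)) z.2⟫)
      ((volume.restrict (Icc a b)).prod (volume : Measure (EuclideanSpace ℝ (Fin 3)))) := by
    have hμ : (volume.restrict (Icc a b)).prod (volume : Measure (EuclideanSpace ℝ (Fin 3))) =
        ((volume : Measure ℝ).prod (volume : Measure (EuclideanSpace ℝ (Fin 3)))).restrict (Icc a b ×ˢ univ) := by
      rw [← Measure.prod_restrict, Measure.restrict_univ]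
    rw [hμ]
    exact hΦ.aestronglyMeasurable (measurableSet_Icc.prod MeasurableSet.univ)
  have hNm : AEStronglyMeasurable
      (fun τ => ∫ x, ⟪blockFn j (v τ) x, blockFn j (convect (v τ) (v τ)) x⟫) (volume.restrict (Icc a b)) :=
    hΦm.integral_prod_right'
  -- the uniform bound (Cauchy–Schwarz)
  have hbound : ∀ τ ∈ Icc a b,
      ‖∫ x, ⟪blockFn j (v τ) x, blockFn j (convect (v τ) (v τ)) x⟫‖ ≤
        ((K.C₂ * E₀) * (K.C₂ * (ENNReal.ofReal M₁ * E₀))).toReal := by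
    intro τ hτ
    have hv2 : MemLp (v τ) 2 volume := ⟨(hns.contDiff_velocity (hsub hτ)).continuous.aestronglyMeasurable,
      (hE₀ τ (hsub' hτ)).trans_lt ENNReal.coe_lt_top⟩
    have hc2 : MemLp (convect (v τ) (v τ)) 2 volume := by
      refine ⟨?_, ?_⟩
      · have hpm : Continuous fun x : EuclideanSpace ℝ (Fin 3) => (τ, x) := continuous_const.prodMk continuous_id
        have : Continuous (convect (v τ) (v τ)) := hcc.comp_continuous hpm fun x => ⟨hτ, mem_univ _⟩
        exact this.aestronglyMeasurable
      · refine (eLpNorm_le_mul_eLpNorm_of_ae_le_mul (f := convect (v τ) (v τ)) (g := v τ) (c := M₁)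
          (Eventually.of_forall fun x => ?_) 2).trans_lt ?_
        · exact (ContinuousLinearMap.le_opNorm _ _).trans
            (mul_le_mul_of_nonneg_right (hM₁ τ (hsub' hτ) x) (norm_nonneg _))
        · exact ENNReal.mul_lt_top ENNReal.ofReal_lt_top hv2.eLpNorm_lt_top
    have hf := memLp_blockFn j hv2 one_le_two
    have hg := memLp_blockFn j hc2 one_le_two
    -- `|∫ ⟪f, g⟫| ≤ ‖f‖₂ ‖g‖₂`
    have hcs : |∫ x, ⟪blockFn j (v τ) x, blockFn j (convect (v τ) (v τ)) x⟫| ≤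
        (eLpNorm (blockFn j (v τ)) 2 volume).toReal * (eLpNorm (blockFn j (convect (v τ) (v τ))) 2 volume).toReal := by
      have e : ∫ x, ⟪blockFn j (v τ) x, blockFn j (convect (v τ) (v τ)) x⟫ = ⟪hf.toLp _, hg.toLp _⟫ := by
        rw [L2.inner_def]
        refine integral_congr_ae ?_
        filter_upwards [hf.coeFn_toLp, hg.coeFn_toLp] with x hfx hgx
        rw [hfx, hgx]
      rw [e, ← Lp.norm_toLp _ hf, ← Lp.norm_toLp _ hg]
      exact abs_real_inner_le_norm _ _
    rw [Real.norm_eq_abs]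
    refine hcs.trans ?_
    rw [← ENNReal.toReal_mul]
    refine ENNReal.toReal_mono (ENNReal.mul_ne_top (ENNReal.mul_ne_top ENNReal.coe_ne_top ENNReal.coe_ne_top)
      (ENNReal.mul_ne_top ENNReal.coe_ne_top (ENNReal.mul_ne_top ENNReal.ofReal_ne_top ENNReal.coe_ne_top))) ?_
    refine mul_le_mul' ((K.blockL2_le hv2 j).trans (by gcongr; exact hE₀ τ (hsub' hτ)))
      ((K.blockL2_le hc2 j).trans ?_)
    gcongr
    refine (eLpNorm_le_mul_eLpNorm_of_ae_le_mul (f := convect (v τ) (v τ)) (g := v τ) (c := M₁)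
      (Eventually.of_forall fun x => ?_) 2).trans (by gcongr; exact hE₀ τ (hsub' hτ))
    exact (ContinuousLinearMap.le_opNorm _ _).trans (mul_le_mul_of_nonneg_right (hM₁ τ (hsub' hτ) x) (norm_nonneg _))
  exact IntegrableOn.of_bound (measure_Icc_lt_top) hNm _ ((ae_restrict_iff' measurableSet_Icc).2
    (Eventually.of_forall hbound))

/-! ## The local step with dissipation -/

/-- **The local transport step, with the viscous term.** Setting of `BlockEnergyTransport.piece_blockEnergy`: a
classical solution `(u, p)` on `ℝ³ × [0, T)` (`ν > 0`), Leray–Hopf from `u 0`, a good restarting time `σ ∈ (0,T)` with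
`‖∇u(σ)‖₂² ≤ A`, a lifespan `d > 0` with `σ + d ≤ T`, `A² d ≤ c₀ ν³` (`LerayLocalRegularH1With c₀`). Then for
`σ < s ≤ t ≤ σ + d`, `t < T`, and every level `j`:
`‖Δ̇_j u(t)‖₂² + 2ν ∫⁻_{(s,t]} ∑_i ‖∂_i Δ̇_j u(τ)‖₂² dτ ≤ ‖Δ̇_j u(s)‖₂² + 2 ∫⁻_{(s,t]} (−N_j(u(τ)))⁺ dτ`
(`gradSq (Δ̇_j u(τ)) = ∑_i ‖∂_i Δ̇_j u(τ)‖₂²`). Along Leray's regular solution `v` from `u(σ)` the exact balance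
`IsSmoothSlabSolution.blockEnergy_eq` splits into its viscous and transfer parts because the transfer part is
integrable in time (`integrableOn_transfer`); `u(σ + ·) = v` pointwise by weak–strong uniqueness and continuity.
[cite: CheskidovShvydkoy2010, Lemma 3.2 (proof, (8))] -/
theorem piece_blockEnergy_visc {ν T : ℝ} (hν : 0 < ν)
    {u : ℝ → EuclideanSpace ℝ (Fin 3) → EuclideanSpace ℝ (Fin 3)} {p : ℝ → EuclideanSpace ℝ (Fin 3) → ℝ}
    (hcl : IsClassicalNSSolutionOn (Ico 0 T) ν 0 u p) (hLH : IsLerayHopfOn T ν 0 (u 0) u)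
    {c₀ : ℝ} (hreg : LerayLocalRegularH1With c₀)
    {σ : ℝ} (hσ : σ ∈ Ioo 0 T) (hLHσ : IsLerayHopfOn (T - σ) ν 0 (u σ) (fun t => u (t + σ)))
    {A d : ℝ} (hA : 0 ≤ A) (hAσ : eWeakGradL2Sq (u σ) ≤ ENNReal.ofReal A) (hd : 0 < d) (hσd : σ + d ≤ T)
    (hAd : A ^ 2 * d ≤ c₀ * ν ^ 3) :
    ∀ s t : ℝ, σ < s → s ≤ t → t ≤ σ + d → t < T → ∀ j : ℤ,
      blockL2 (u t) j ^ 2 + 2 * ENNReal.ofReal ν * ∫⁻ τ in Ioc s t, gradSq (blockFn j (u τ)) ≤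
        blockL2 (u s) j ^ 2 + 2 * ∫⁻ τ in Ioc s t, ENNReal.ofReal
          (-(∫ x, ⟪blockFn j (u τ) x, blockFn j (convect (u τ) (u τ)) x⟫)) := by
  have hu2 : MemLp (u σ) 2 volume := hLH.memLp σ ⟨hσ.1.le, hσ.2.le⟩
  have hdiv : IsWeaklyDivFree (u σ) := hLHσ.isWeaklyDivFree_datum (sub_pos.2 hσ.2)
  obtain ⟨v, q, hv, -, hvreg, hns, hclv⟩ := hreg hν hd hu2 hdiv hA hAσ hAd
  have hLHσ' : IsLerayHopfOn d ν 0 (u σ) (fun t => u (t + σ)) := hLHσ.of_le (by linarith)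
  have hS : MemLqLp ∞ 6 v (Ioo 0 d) :=
    memLqLp_top_six_of_isH1RegularOn_Icc hvreg fun t ht => hv.memLp t ht
  have hqr : 2 / (∞ : ℝ≥0∞) + 3 / 6 ≤ 1 := by
    rw [ENNReal.div_top, zero_add]
    exact ENNReal.div_le_of_le_mul (by norm_num)
  have hae : ∀ t ∈ Ioc 0 d, u (t + σ) =ᵐ[volume] v t := fun t ht =>
    serrin_weak_strong_uniqueness_holds hν hd hv hu2 (q := ∞) (r := 6) (by norm_num) hqr hS hLHσ' t ht
  have heq : ∀ τ ∈ Ioc σ (σ + d), τ < T → u τ = v (τ - σ) := by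
    intro τ hτ hτT
    have h1 : u τ =ᵐ[volume] v (τ - σ) := by
      have h := hae (τ - σ) ⟨sub_pos.2 hτ.1, by linarith [hτ.2]⟩
      rwa [sub_add_cancel] at h
    have hcu : Continuous (u τ) := (hcl.contDiff_velocity ⟨hσ.1.le.trans hτ.1.le, hτT⟩).continuous
    have hcv : Continuous (v (τ - σ)) :=
      (hns.contDiff_velocity ⟨sub_pos.2 hτ.1, by linarith [hτ.2]⟩).continuous
    exact (Continuous.ae_eq_iff_eq volume hcu hcv).1 h1
  -- uniform energy bound along `v`
  obtain ⟨E₀, hE₀⟩ := exists_eLpNorm_slice_le hv hν.le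
  intro s t hs hst htd htT j
  rcases hst.eq_or_lt with rfl | hst'
  · simp only [Ioc_self, Measure.restrict_empty, lintegral_zero_measure, mul_zero, add_zero, le_refl]
  have ha' : 0 < s - σ := sub_pos.2 hs
  have hab' : s - σ < t - σ := by linarith
  have hb'd : t - σ ≤ d := by linarith
  obtain ⟨hSob, hSobdt, hsup, hp⟩ := hclv (s - σ) ha' (hab'.le.trans hb'd)
  have hslab : IsSmoothSlabSolution (s - σ) (t - σ) ν v q :=
    isSmoothSlabSolution_of_regular hns ha' hab' hb'd hSob hSobdt hsup hp
  have hE := hslab.blockEnergy_eq j le_rfl hab'.le le_rfl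
  -- uniform bounds on `[s - σ, d]`
  obtain ⟨M₀, hM₀'⟩ := hsup 0
  obtain ⟨M₁, hM₁'⟩ := hsup 1
  have hM₀ : ∀ τ ∈ Icc (s - σ) d, ∀ x, ‖v τ x‖ ≤ M₀ := fun τ hτ x => by
    simpa [norm_iteratedFDeriv_zero] using hM₀' τ hτ x
  have hM₁ : ∀ τ ∈ Icc (s - σ) d, ∀ x, ‖fderiv ℝ (v τ) x‖ ≤ M₁ := fun τ hτ x => by
    have h := hM₁' τ hτ x
    rwa [← norm_iteratedFDeriv_fderiv, norm_iteratedFDeriv_zero] at h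
  have hE₀' : ∀ τ ∈ Icc (s - σ) d, eLpNorm (v τ) 2 volume ≤ E₀ := fun τ hτ =>
    hE₀ τ ⟨ha'.le.trans hτ.1, hτ.2⟩
  -- the three time integrands along `v`
  set S : ℝ → ℝ := fun τ => ∑ i, ∫ x, ‖fderiv ℝ (blockFn j (v τ)) x
      (stdOrthonormalBasis ℝ (EuclideanSpace ℝ (Fin 3)) i)‖ ^ 2 with hSdef
  set N : ℝ → ℝ := fun τ => ∫ x, ⟪blockFn j (v τ) x, blockFn j (convect (v τ) (v τ)) x⟫ with hNdef
  set G : ℝ → ℝ≥0∞ := fun τ => ENNReal.ofReal (-(N τ)) with hGdef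
  have hNint : IntervalIntegrable N volume (s - σ) (t - σ) := by
    refine IntegrableOn.intervalIntegrable ?_
    rw [uIcc_of_le hab'.le]
    exact integrableOn_transfer hns ha' hab'.le hb'd hM₀ hM₁ hE₀' j
  have hgint : IntervalIntegrable (fun τ => -ν * S τ - N τ) volume (s - σ) (t - σ) :=
    hslab.intervalIntegrable_rhs j le_rfl hab'.le le_rfl
  have hSint : IntervalIntegrable S volume (s - σ) (t - σ) := by
    have h := ((hgint.add hNint).neg).mul_const ν⁻¹
    refine h.congr fun τ _ => ?_
    simp only [Pi.neg_apply]
    field_simp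
    ring
  -- the exact balance, split
  have hE' : (∫ x, ‖blockFn j (v (t - σ)) x‖ ^ 2) - ∫ x, ‖blockFn j (v (s - σ)) x‖ ^ 2 =
      2 * (-ν * (∫ τ in (s - σ)..(t - σ), S τ) - ∫ τ in (s - σ)..(t - σ), N τ) := by
    rw [hE, intervalIntegral.integral_sub (hSint.const_mul (-ν)) hNint, intervalIntegral.integral_const_mul]
  have hS0 : ∀ τ, 0 ≤ S τ := fun τ => Finset.sum_nonneg fun i _ => integral_nonneg fun x => by positivity
  have hIS0 : 0 ≤ ∫ τ in (s - σ)..(t - σ), S τ := intervalIntegral.integral_nonneg hab'.le fun τ _ => hS0 τ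
  -- block energies as real integrals
  have hsm : ∀ τ ∈ Icc (s - σ) (t - σ), IsSmoothL2Field (v τ) := fun τ hτ => hslab.smooth_slice τ hτ
  have hfin : ∀ τ ∈ Icc (s - σ) (t - σ), blockL2 (v τ) j ^ 2 ≠ ∞ := fun τ hτ =>
    ENNReal.pow_ne_top (((hsm τ hτ).blockFn j).memLp_two).eLpNorm_ne_top
  have hEq : ∀ τ ∈ Icc (s - σ) (t - σ), ∫ x, ‖blockFn j (v τ) x‖ ^ 2 = (blockL2 (v τ) j ^ 2).toReal :=
    fun τ hτ => integral_norm_sq_eq_toReal_eLpNorm_sq (((hsm τ hτ).blockFn j).memLp_two).1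
  have htI : t - σ ∈ Icc (s - σ) (t - σ) := ⟨hab'.le, le_rfl⟩
  have hsI : s - σ ∈ Icc (s - σ) (t - σ) := ⟨le_rfl, hab'.le⟩
  -- the dissipation integrand: `gradSq (Δ̇_j v τ) = ofReal (S τ)` on the slab
  have hgradS : ∀ τ ∈ Icc (s - σ) (t - σ), gradSq (blockFn j (v τ)) = ENNReal.ofReal (S τ) := by
    intro τ hτ
    have hw : IsSmoothL2Field (blockFn j (v τ)) := (hsm τ hτ).blockFn j
    have hfin' : ∀ i, eLpNorm (fun x => fderiv ℝ (blockFn j (v τ)) x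
        (stdOrthonormalBasis ℝ (EuclideanSpace ℝ (Fin 3)) i)) 2 volume ^ 2 ≠ ∞ := fun i =>
      ENNReal.pow_ne_top (hw.memLp_fderiv_apply _).eLpNorm_ne_top
    simp only [hSdef, gradSq]
    rw [ENNReal.ofReal_sum_of_nonneg (fun i _ => integral_nonneg fun x => by positivity)]
    refine Finset.sum_congr rfl fun i _ => ?_
    rw [integral_norm_sq_eq_toReal_eLpNorm_sq (hw.memLp_fderiv_apply _).1, ENNReal.ofReal_toReal (hfin' i)]
  have hlinS : ∫⁻ τ in Ioc (s - σ) (t - σ), gradSq (blockFn j (v τ)) =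
      ENNReal.ofReal (∫ τ in (s - σ)..(t - σ), S τ) := by
    rw [intervalIntegral.integral_of_le hab'.le,
      ofReal_integral_eq_lintegral_ofReal hSint.1 (Eventually.of_forall fun τ => hS0 τ)]
    exact setLIntegral_congr_fun measurableSet_Ioc fun τ hτ => hgradS τ ⟨hτ.1.le, hτ.2⟩
  -- the transfer integrand: `ofReal (∫ (-N)) ≤ ∫⁻ ofReal (-N)`
  have hlinN : ENNReal.ofReal (-(∫ τ in (s - σ)..(t - σ), N τ)) ≤ ∫⁻ τ in Ioc (s - σ) (t - σ), G τ := by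
    rw [← intervalIntegral.integral_neg, intervalIntegral.integral_of_le hab'.le]
    have hni : Integrable (fun τ => -N τ) (volume.restrict (Ioc (s - σ) (t - σ))) := hNint.1.neg
    calc ENNReal.ofReal (∫ τ in Ioc (s - σ) (t - σ), -N τ)
        ≤ ENNReal.ofReal (∫ τ in Ioc (s - σ) (t - σ), max (-N τ) 0) :=
          ENNReal.ofReal_le_ofReal (integral_mono hni hni.pos_part fun τ => le_max_left _ _)
      _ = ∫⁻ τ in Ioc (s - σ) (t - σ), ENNReal.ofReal (max (-N τ) 0) :=
          ofReal_integral_eq_lintegral_ofReal hni.pos_part (Eventually.of_forall fun τ => le_max_right _ _)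
      _ = ∫⁻ τ in Ioc (s - σ) (t - σ), G τ := lintegral_congr fun τ => by
          simp only [hGdef]
          rcases le_total (-N τ) 0 with h | h
          · rw [max_eq_right h, ENNReal.ofReal_zero, ENNReal.ofReal_of_nonpos h]
          · rw [max_eq_left h]
  -- the inequality along `v`
  have hineq : blockL2 (v (t - σ)) j ^ 2 +
      2 * ENNReal.ofReal ν * ∫⁻ τ in Ioc (s - σ) (t - σ), gradSq (blockFn j (v τ)) ≤
      blockL2 (v (s - σ)) j ^ 2 + 2 * ∫⁻ τ in Ioc (s - σ) (t - σ), G τ := by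
    have h1 : (blockL2 (v (t - σ)) j ^ 2).toReal + 2 * ν * (∫ τ in (s - σ)..(t - σ), S τ) =
        (blockL2 (v (s - σ)) j ^ 2).toReal + 2 * (-(∫ τ in (s - σ)..(t - σ), N τ)) := by
      rw [← hEq _ htI, ← hEq _ hsI]; linarith [hE']
    have hνS : 0 ≤ 2 * ν * ∫ τ in (s - σ)..(t - σ), S τ := by positivity
    calc blockL2 (v (t - σ)) j ^ 2 + 2 * ENNReal.ofReal ν * ∫⁻ τ in Ioc (s - σ) (t - σ), gradSq (blockFn j (v τ))
        = ENNReal.ofReal ((blockL2 (v (t - σ)) j ^ 2).toReal + 2 * ν * ∫ τ in (s - σ)..(t - σ), S τ) := by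
          rw [hlinS, ENNReal.ofReal_add ENNReal.toReal_nonneg hνS, ENNReal.ofReal_toReal (hfin _ htI),
            ENNReal.ofReal_mul (by positivity), ENNReal.ofReal_mul zero_le_two, ENNReal.ofReal_ofNat]
      _ = ENNReal.ofReal ((blockL2 (v (s - σ)) j ^ 2).toReal + 2 * (-(∫ τ in (s - σ)..(t - σ), N τ))) := by rw [h1]
      _ ≤ ENNReal.ofReal ((blockL2 (v (s - σ)) j ^ 2).toReal) +
            ENNReal.ofReal (2 * (-(∫ τ in (s - σ)..(t - σ), N τ))) := ENNReal.ofReal_add_le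
      _ = blockL2 (v (s - σ)) j ^ 2 + 2 * ENNReal.ofReal (-(∫ τ in (s - σ)..(t - σ), N τ)) := by
          rw [ENNReal.ofReal_toReal (hfin _ hsI), ENNReal.ofReal_mul zero_le_two, ENNReal.ofReal_ofNat]
      _ ≤ blockL2 (v (s - σ)) j ^ 2 + 2 * ∫⁻ τ in Ioc (s - σ) (t - σ), G τ := by gcongr
  -- translate `τ ↦ τ + σ` and return to `u`
  have htrans : ∀ Φ : ℝ → ℝ≥0∞, ∫⁻ τ in Ioc (s - σ) (t - σ), Φ τ = ∫⁻ τ in Ioc s t, Φ (τ - σ) := by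
    intro Φ
    rw [← lintegral_indicator measurableSet_Ioc, ← lintegral_indicator measurableSet_Ioc,
      ← lintegral_sub_right_eq_self (fun τ => (Ioc (s - σ) (t - σ)).indicator Φ τ) σ]
    refine lintegral_congr fun τ => ?_
    by_cases h : τ ∈ Ioc s t
    · have h' : τ - σ ∈ Ioc (s - σ) (t - σ) := ⟨by linarith [h.1], by linarith [h.2]⟩
      rw [indicator_of_mem h, indicator_of_mem h']
    · have h' : τ - σ ∉ Ioc (s - σ) (t - σ) := fun h' => h ⟨by linarith [h'.1], by linarith [h'.2]⟩
      rw [indicator_of_notMem h, indicator_of_notMem h']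
  have hequ : ∀ τ ∈ Ioc s t, u τ = v (τ - σ) := fun τ hτ =>
    heq τ ⟨hs.trans hτ.1, hτ.2.trans htd⟩ (hτ.2.trans_lt htT)
  have hcongrS : ∫⁻ τ in Ioc s t, gradSq (blockFn j (v (τ - σ))) = ∫⁻ τ in Ioc s t, gradSq (blockFn j (u τ)) :=
    setLIntegral_congr_fun measurableSet_Ioc fun τ hτ => by rw [hequ τ hτ]
  have hcongrN : ∫⁻ τ in Ioc s t, G (τ - σ) = ∫⁻ τ in Ioc s t, ENNReal.ofReal
      (-(∫ x, ⟪blockFn j (u τ) x, blockFn j (convect (u τ) (u τ)) x⟫)) :=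
    setLIntegral_congr_fun measurableSet_Ioc fun τ hτ => by simp only [hGdef, hNdef, hequ τ hτ]
  have h1 : ∫⁻ τ in Ioc (s - σ) (t - σ), gradSq (blockFn j (v τ)) =
      ∫⁻ τ in Ioc s t, gradSq (blockFn j (v (τ - σ))) := htrans _
  have h2 : ∫⁻ τ in Ioc (s - σ) (t - σ), G τ = ∫⁻ τ in Ioc s t, G (τ - σ) := htrans _
  rw [h1, h2, hcongrS, hcongrN] at hineq
  rw [heq t ⟨hs.trans hst', htd⟩ htT, heq s ⟨hs, hst'.le.trans htd⟩ (hst'.trans htT)]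
  exact hineq

end Summit.NavierStokesRegularity.FluidComputer.BlockEnergyDissipation

end
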